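/-
Copyright (c) 2026 the pub-hodgecm-mathlib formalisation cell (harness21).  Prover seat hodgecm-mathlib-R90-C10-p01 (g3), SLAB R90-TF, section S1 «Ch. 10∕12 local»;
crux H413 = `stmt-HodgeConjecture-24833`; line «B_pos» RAMIFIED TAME corner — card (8⁺) «the `HEram` payer» dealt BY NAME by R90-C10-plan (g3) (2026-09-05T01:56:53Z),
FILE (8⁺a) of its two-file cut.  KERNEL module: THEOREMS ONLY (no definition, no named fact, no `sorry`, no instance, no notation).  2026-09-05.
-/
import Summits.HodgeConjecture.HodgeConjecture.Theorems.R90S1KeysThmTwoPosDepthBranchBRamifiedTameLeaf   -- ★ p864247 (8) (this seat): the letter `HEram` whose ∃-body §2 concludes VERBATIM; brings the frame, the `SmoothInd` carrier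
import Summits.HodgeConjecture.HodgeConjecture.Theorems.R90S1BranchBShellZeroRamified              -- ★ (R90-C10-p01 (g2)): `preimage_heisHomeomorph_setOf_v_le_one`, `isCompact_setOf_v_le_one_of_v_two`, `entry_zero_two_heisElt`; brings ★ `valued_heisZ_apply_eq_max`, ★ `exists_measure_eq_mul_of_preimage_heisHomeomorph`, ★ `valued_skew_apply_lt_one_of_ramified`
import Summits.HodgeConjecture.HodgeConjecture.Theorems.R90S1BposRamShellMeasurability             -- ★ (B-10)(6b)(A) (R90-C10-p08 (g2)): `measureReal_setOf_valued_le_exp_any` (`μ_R{|x| ≤ eᵗ} = (N𝔓_w)ᵗ μ_R(𝒪)`, any place)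
import Summits.HodgeConjecture.HodgeConjecture.Theorems.R90S1BposCutoffShellSum                    -- ★ p864150 part 3a (R90-C10-p06 (g3)): `iUnion_shell_cut_eq_cutoff` (the cut-off as the union of its shells — measurability)
import Summits.HodgeConjecture.HodgeConjecture.Theorems.K2E3BranchBShellScalingFromWeightSeries     -- ★ (K2E3-p06): `integrableOn_F₀_S_ge` (`F₀` integrable on `{|z| ≥ 1}` for a contracting `χ₁`, any place)
import Summits.HodgeConjecture.HodgeConjecture.Theorems.R90S1BposSkewBallCharacterTools             -- ★ (R90-C10-p04 (g2)): `isOpen_setOf_valued_le_valued` (closed balls of `L_w` are open)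
import HarnessLib

/-!
# R90-TF · S1 «Ch10-local» ∕ K2 E3 «U4Keys» :182, BRANCH B AT POSITIVE DEPTH, TAMELY RAMIFIED PLACE — (8⁺a) THE FOUR CASSELMAN-PAIR ENTRIES FROM THE CUT-OFF INTEGRALS:
# the ∃-body of the letter `HEram` of ★ (8) from (i) the four pointwise indicator identities of the type basis, (ii) the two cut-off values `∫_{C(ν,j₀)} F₀ = C·X·(1−X)⁻¹`
# and (iii) the dichotomy «`C = 0` ∨ (`hFε` ∧ `C²X = (q^ν μ B(ν,0))²·(q−1)²·q^{−(2ν+1)}`)» — with the RAMIFIED BOX VOLUME `μ B(ν,j) = q^{−ν}·μ(N₀)`, `j ∈ {0,1}`, proved here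
# [Keys1984 §3, §7 Thm (2) (d); Casselman1980 §3; Roche1998 §3–§4; Rogawski1990 §1.10, §4.9, §12.2]

Cell `pub/hodgecm-mathlib`, crux H413 = `stmt-HodgeConjecture-24833`, route of record `HCCMUnconditional` (no route verbs); R90-TF section S1, dealer R90-C10-plan (g3), line lead
R90-C10-p05 (g2), auditor R90-C10-audit1 (g3).  THEOREMS ONLY; lane `--supports stmt-HodgeConjecture-24833 --as helper`, count-neutral.  NOT THE PAYER of :182: this is the
ramified twin of R90-C10-p02 (g3)'s inert FILE C «entries of master»; its three letters are paid by (i) p02's FILE B «indicators» at `r₁ = r₂ = ν` (★ FILE A p864028 + A′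
pointwise), (ii) ★-pending (6c) `R90S1BposRamMasterIntegral.setIntegral_cutoff_eq_of_even_odd_shells` (R90-C10-p06 (g3)) fed the shell letters of (6a)(6b), (iii) FILE (8⁺b).

WHAT.  In the (G3) frame at a tame ramified `w` (`he`, `|2|_w = 1`), for a Haar measure `μ` on `N(L⁺_v)`, the normalised `(J_e, θ)`-type basis `(f₁, f_w)` of `i(χ₁, 1)` at
`e = (ν, 0; ν, 1)` has the four cell integrands `f₁(w₀n) = 𝟙_{C(ν,1)}·F₀`, `f_w(w₀nw₀) = 𝟙_{C(ν,0)}·F₀`, `f_w(w₀n) = 𝟙_{B(ν,0)}`, `f₁(w₀nw₀) = 𝟙_{B(ν,1)}` (letters (i);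
`C(ρ,j₀) = {exp j₀ ≤ |z|_w ∧ |x|_w ≤ |ϖ|^ρ·|z|_w}` = the cut-off of ★ part 3a ∕ (6c), `B(ρ,j) = {|z|_w ≤ |ϖ|ʲ ∧ |x|_w ≤ |ϖ|^ρ}`, `F₀(n) = χ₁(σẑ)⁻¹‖ẑ‖⁻¹` the frame-v1 dite);
so the four ENTRIES are `∫_{C(ν,1)} F₀`, `∫_{C(ν,0)} F₀` (letters (ii): both `= C·X·(1−X)⁻¹`, `X = χ₁(σΠ·Π)`) and the two box volumes.  AT A RAMIFIED TAME PLACE THE TWO BOXES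
HAVE THE SAME VOLUME `q^{−ν}·μ(N₀)` (§1: in the Heisenberg chart both are `{|x| ≤ |ϖ|^ν} × 𝒪⁻`, because `|z| = max(|x|², |y|)` and a skew `y` with `|y| ≤ 1` has `|y| ≤ |ϖ|`),
so `V₁ = V₂ = V := q^ν·μ(B(ν,0))` (the dealer's V OF RECORD, R-S1-27), and with `Γ := C∕V` the dichotomy (iii) «`C = 0` ∨ (`hFε` ∧ `C²X = V²·(q−1)²·q^{−(2ν+1)}`)» is exactly
«(R-a) both big-cell entries vanish ∣ (R-b) the Γ-shapes with `Γ²X = (q−1)²q^{−(2ν+1)}`».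
* §1 **`measureReal_box_eq_ram`** — `μ.real B(ν,j) = (N𝔓_w)^(−ν) · μ.real N₀` for `j ≤ 1 ≤ ν` (chart ★ `exists_measure_eq_mul_of_preimage_heisHomeomorph`, ★ (A) ball scaling).
* §2 **`HEram_body_of_cutoffs`** — letters (i)(ii)(iii) ⊢ the ∃-body of `HEram` (★ (8) l. 264–285) VERBATIM.
HONEST LABEL.  HC_CM is proved only modulo the 7 printed citations (2 remaining named inputs: hLiu418 = `stmt-HodgeConjecture-24832`, h413 = `stmt-HodgeConjecture-24833`) until
rung 0 closes; this file closes NOTHING at rung 0 (three letters open); (S-RT) ∕ :182 ∕ A2′ OPEN; REL ≠ ★ ≠ BUILT.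

## References
* [Keys1984] D. Keys, *Principal series representations of special unitary groups over local fields*, Compositio Math. 51 (1984), §3, §7 Theorem (2) (d) p. 126.
* [Casselman1980] W. Casselman, *The unramified principal series of p-adic groups I*, Compositio Math. 40 (1980), §3.
* [Roche1998] A. Roche, *Types and Hecke algebras for principal series representations of split reductive p-adic groups*, Ann. Sci. ÉNS (4) 31 (1998), §3–§4.
* [Rogawski1990] J. D. Rogawski, *Automorphic Representations of Unitary Groups in Three Variables*, Ann. of Math. Stud. 123 (1990), §1.10 p. 9, §4.9 p. 54, §12.2 p. 173.
-/

set_option autoImplicit false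
-- the mandated namespace has the single-problem summit's repeated segment (`HodgeConjecture.HodgeConjecture`)
set_option linter.dupNamespace false

noncomputable section

open NumberField IsDedekindDomain MeasureTheory
open scoped Matrix MatrixGroups WithZero Valued NNReal ENNReal
open Literature.NumberTheory Literature.NumberTheory.Automorphic Literature.NumberTheory.Automorphic.UnitaryGroup
open Literature.NumberTheory.Rogawski1990

namespace Summit.HodgeConjecture.HodgeConjecture.R90.S1.BposRamPairEntriesOfShells

open Summit.HodgeConjecture.HodgeConjecture.Cruxes.H413
open Summit.HodgeConjecture.HodgeConjecture.Cruxes.H413.K2E3DepthZeroIwahoriCharacterCM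
open Summit.HodgeConjecture.HodgeConjecture.R90.S1

-- the frame's `GL (Fin 3)` carriers were elaborated under `open Classical` (decidability instances must match)
open Classical

variable (L : Type) [Field L] [NumberField L] [IsCMField L] (v : HeightOneSpectrum (𝓞 ↥(maximalRealSubfield L)))
  (w : PlacesOver L v) (hw : IsCMField.complexConj L • w.1 = w.1)

/-! ## §0 Frame lemmas: the `(0,1)` entry of the chart, continuity of the two entries, the boxes are open -/

set_option maxHeartbeats 1600000 in
set_option synthInstance.maxHeartbeats 400000 in
-- the carrier ascription `N = unipotentU` + the GL-coercion chain (whnf past 200000 on the current toolchain; ★ twin `entry_zero_two_heisElt`)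
/-- The `(0, 1)` entry of the chart element `u(x, y)` is `x` (★ `mat_heisElt`, ★ `heisMatrix`). [cite: Rogawski1990, §1.10 p. 9] -/
theorem entry_zero_one_heisElt [Invertible (2 : LocalRing L v)] (x : LocalRing L v) (y : ↥(HeisRing.skewPart (conjLocal L (IsCMField.complexConj L) v))) :
    (((((HeisRing.heisElt (conjLocal L (IsCMField.complexConj L) v) (conjLocal_conjLocal_cm L v) (cmLocalForm_eq_over L 3 v) x y :
        ↥(cmBorelTriple L 3 v).N) : ↥(unitaryGroupOfForm (conjLocal L (IsCMField.complexConj L) v) (cmLocalForm L 3 v))) : GL (Fin 3) (LocalRing L v)) :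
          Matrix (Fin 3) (Fin 3) (LocalRing L v)) 0 1) = x := by
  rw [HeisRing.mat_heisElt, HeisRing.coe_heisGL]
  rfl

/-- `n ↦ x(n) = n₀₁` is continuous on `N(L⁺_v)` (as ★ `continuous_entry_zero_two`). [cite: Rogawski1990, §1.10 p. 9] -/
theorem continuous_entry_zero_one :
    Continuous (fun n : ↥(cmBorelTriple L 3 v).N => ((n : ↥(unitaryGroupOfForm (conjLocal L (IsCMField.complexConj L) v) (cmLocalForm L 3 v))) : GL (Fin 3) (LocalRing L v)).val 0 1) := by
  have h1 : Continuous (fun n : ↥(cmBorelTriple L 3 v).N => (n : ↥(unitaryGroupOfForm (conjLocal L (IsCMField.complexConj L) v) (cmLocalForm L 3 v)))) := continuous_subtype_val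
  have h2 : Continuous (fun u : ↥(unitaryGroupOfForm (conjLocal L (IsCMField.complexConj L) v) (cmLocalForm L 3 v)) => (u : GL (Fin 3) (LocalRing L v))) := continuous_subtype_val
  have h3 : Continuous (fun g : GL (Fin 3) (LocalRing L v) => g.val) := Units.continuous_val
  exact (h3.comp (h2.comp h1)).matrix_elem 0 1

/-- `C·X·(1−X)⁻¹ = V·((C∕V)·X∕(1−X))` for `V ≠ 0` — the Γ-shape of ★ (7) with `Γ := C∕V`. [cite: Keys1984, §7 Theorem (2) (d) p. 126] -/
theorem entry_shape (C V X : ℂ) (hV : V ≠ 0) : C * X * (1 - X)⁻¹ = V * (C / V * X / (1 - X)) := by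
  rw [show V * (C / V * X / (1 - X)) = V * C / V * X * (1 - X)⁻¹ by ring, mul_div_cancel_left₀ C hV]

/-- **The boxes `B(ρ, j) = {|z|_w ≤ |ϖ|ʲ ∧ |x|_w ≤ |ϖ|^ρ}` are OPEN (hence Borel)** in `N(L⁺_v)` (`ϖ ≠ 0`; the closed balls of `L_w` are open ★). [cite: Rogawski1990, §1.10 p. 9] -/
theorem isOpen_box {ϖ : w.1.adicCompletion L} (hϖ : Valued.v ϖ = WithZero.exp (-1 : ℤ)) (ρ j : ℕ) :
    IsOpen {n : ↥(cmBorelTriple L 3 v).N | Valued.v ((((((n : ↥(unitaryGroupOfForm (conjLocal L (IsCMField.complexConj L) v) (cmLocalForm L 3 v)))) : GL (Fin 3) (LocalRing L v)) : Matrix (Fin 3) (Fin 3) (LocalRing L v)) 0 2) w) ≤ Valued.v ϖ ^ j ∧ Valued.v ((((((n : ↥(unitaryGroupOfForm (conjLocal L (IsCMField.complexConj L) v) (cmLocalForm L 3 v)))) : GL (Fin 3) (LocalRing L v)) : Matrix (Fin 3) (Fin 3) (LocalRing L v)) 0 1) w) ≤ Valued.v ϖ ^ ρ} := by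
  have hϖ0 : ∀ k : ℕ, Valued.v (ϖ ^ k) ≠ 0 := fun k => by
    rw [map_pow, hϖ]; exact pow_ne_zero _ WithZero.coe_ne_zero
  have hz : IsOpen {x : LocalRing L v | Valued.v (x w) ≤ Valued.v ϖ ^ j} := by
    have e : {x : LocalRing L v | Valued.v (x w) ≤ Valued.v ϖ ^ j} = (fun x : LocalRing L v => x w) ⁻¹' {z : w.1.adicCompletion L | Valued.v z ≤ Valued.v (ϖ ^ j)} :=
      Set.ext fun _ => by rw [Set.mem_preimage, Set.mem_setOf_eq, Set.mem_setOf_eq, map_pow]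
    rw [e]
    exact (BposSkewBallCharacterTools.isOpen_setOf_valued_le_valued L v w (hϖ0 j)).preimage (continuous_apply w)
  have hx : IsOpen {x : LocalRing L v | Valued.v (x w) ≤ Valued.v ϖ ^ ρ} := by
    have e : {x : LocalRing L v | Valued.v (x w) ≤ Valued.v ϖ ^ ρ} = (fun x : LocalRing L v => x w) ⁻¹' {z : w.1.adicCompletion L | Valued.v z ≤ Valued.v (ϖ ^ ρ)} :=
      Set.ext fun _ => by rw [Set.mem_preimage, Set.mem_setOf_eq, Set.mem_setOf_eq, map_pow]
    rw [e]
    exact (BposSkewBallCharacterTools.isOpen_setOf_valued_le_valued L v w (hϖ0 ρ)).preimage (continuous_apply w)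
  exact (hz.preimage (K2E3BranchBShellRegions.continuous_entry_zero_two L v)).inter (hx.preimage (continuous_entry_zero_one L v))

/-! ## §1 The ramified box volume: `μ B(ν, j) = q^{−ν} · μ N₀` for `j ≤ 1 ≤ ν` -/

include hw in
set_option maxHeartbeats 1600000 in
set_option synthInstance.maxHeartbeats 400000 in
-- the GL-coercion chain in the sets (class of ★ `preimage_heisHomeomorph_setOf_v_le_one`)
/-- **In the Heisenberg chart, `B(ν, j) = {|x|_w ≤ |ϖ|^ν} × 𝒪⁻` for `j ≤ 1 ≤ ν` at a TAME RAMIFIED place**: `|z|_w = max(|x|_w², |y|_w)` (★ `valued_heisZ_apply_eq_max`,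
`|2|_w = 1`); `|x| ≤ |ϖ|^ν ≤ |ϖ|` gives `|x|² ≤ |ϖ|² ≤ |ϖ|ʲ`, and a skew `y` with `|y|_w ≤ 1` has `|y|_w < 1` (★ `valued_skew_apply_lt_one_of_ramified`, `e(w|v) ≠ 1`), i.e.
`|y|_w ≤ |ϖ| ≤ |ϖ|ʲ` — so BOTH boxes `j = 0, 1` have the same chart preimage. [cite: Rogawski1990, §1.10 p. 9; §4.9 p. 54; §12.2 p. 173] -/
theorem preimage_heisHomeomorph_box [Invertible (2 : LocalRing L v)] (he : v.asIdeal.ramificationIdx' w.1.asIdeal ≠ 1) (h2w : Valued.v (2 : w.1.adicCompletion L) = 1)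
    {ϖ : w.1.adicCompletion L} (hϖ : Valued.v ϖ = WithZero.exp (-1 : ℤ)) {ν j : ℕ} (hν : 1 ≤ ν) (hj : j ≤ 1) :
    (HeisRing.heisHomeomorph (conjLocal L (IsCMField.complexConj L) v) (conjLocal_conjLocal_cm L v) (continuous_conjLocal L (IsCMField.complexConj L) v)
        (cmLocalForm_eq_over L 3 v)) ⁻¹' {n : ↥(cmBorelTriple L 3 v).N | Valued.v ((((((n : ↥(unitaryGroupOfForm (conjLocal L (IsCMField.complexConj L) v) (cmLocalForm L 3 v)))) : GL (Fin 3) (LocalRing L v)) : Matrix (Fin 3) (Fin 3) (LocalRing L v)) 0 2) w) ≤ Valued.v ϖ ^ j ∧ Valued.v ((((((n : ↥(unitaryGroupOfForm (conjLocal L (IsCMField.complexConj L) v) (cmLocalForm L 3 v)))) : GL (Fin 3) (LocalRing L v)) : Matrix (Fin 3) (Fin 3) (LocalRing L v)) 0 1) w) ≤ Valued.v ϖ ^ ν} =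
      {x : LocalRing L v | Valued.v (x w) ≤ Valued.v ϖ ^ ν} ×ˢ {y : ↥(HeisRing.skewPart (conjLocal L (IsCMField.complexConj L) v)) | Valued.v ((y : LocalRing L v) w) ≤ 1} := by
  have hϖ1 : Valued.v ϖ < 1 := by rw [hϖ, ← WithZero.exp_zero]; exact WithZero.exp_lt_exp.2 (by norm_num)
  have hϖj1 : Valued.v ϖ ^ j ≤ 1 := pow_le_one₀ zero_le hϖ1.le
  have hϖν : Valued.v ϖ ^ ν ≤ Valued.v ϖ := by
    calc Valued.v ϖ ^ ν ≤ Valued.v ϖ ^ 1 := pow_le_pow_right_of_le_one' hϖ1.le hν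
      _ = Valued.v ϖ := pow_one _
  have hϖ2j : Valued.v ϖ * Valued.v ϖ ≤ Valued.v ϖ ^ j := by
    calc Valued.v ϖ * Valued.v ϖ = Valued.v ϖ ^ 2 := (sq _).symm
      _ ≤ Valued.v ϖ ^ j := pow_le_pow_right_of_le_one' hϖ1.le (by omega)
  have hϖj : Valued.v ϖ ≤ Valued.v ϖ ^ j := by
    calc Valued.v ϖ = Valued.v ϖ ^ 1 := (pow_one _).symm
      _ ≤ Valued.v ϖ ^ j := pow_le_pow_right_of_le_one' hϖ1.le hj
  ext ⟨x, y⟩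
  simp only [Set.mem_preimage, Set.mem_setOf_eq, HeisRing.heisHomeomorph_apply, Set.mem_prod]
  rw [entry_zero_two_heisElt, entry_zero_one_heisElt, K2E3BranchBSkewLineIntegrals.valued_heisZ_apply_eq_max L v w hw h2w x y, max_le_iff]
  constructor
  · rintro ⟨⟨-, hy⟩, hx⟩
    exact ⟨hx, hy.trans hϖj1⟩
  · rintro ⟨hx, hy⟩
    have hy' : Valued.v ((y : LocalRing L v) w) ≤ Valued.v ϖ := by
      rw [hϖ, ← valued_lt_one_iff_le_exp_neg_one L v w]
      exact valued_skew_apply_lt_one_of_ramified L v w hw he h2w y hy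
    exact ⟨⟨(mul_le_mul' (hx.trans hϖν) (hx.trans hϖν)).trans hϖ2j, hy'.trans hϖj⟩, hx⟩

include hw in
set_option maxHeartbeats 1600000 in
set_option synthInstance.maxHeartbeats 400000 in
-- the chart bookkeeping with the GL-coercion chain in every set (class of ★ `measure_setOf_v_lt_one_eq_ram`)
/-- **THE RAMIFIED BOX VOLUME.**  `v` non-split, RAMIFIED in `L` (`he`), `|2|_w = 1`, `|ϖ|_w = exp(−1)`, `j ≤ 1 ≤ ν`; `μ` ANY Haar measure on `N(L⁺_v)`.  Then
**`μ.real B(ν, j) = (N𝔓_w)^(−ν) · μ.real N₀`**, `B(ν,j) = {|z|_w ≤ |ϖ|ʲ ∧ |x|_w ≤ |ϖ|^ν}`, `N₀ = {|z|_w ≤ 1}`: in the chart `B(ν,j) = {|x| ≤ |ϖ|^ν} × 𝒪⁻`, `N₀ = 𝒪 × 𝒪⁻` (★), the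
product evaluation ★ `exists_measure_eq_mul_of_preimage_heisHomeomorph` and `μ_R{|x| ≤ |ϖ|^ν} = (N𝔓_w)^(−ν) μ_R(𝒪)` (★ (A)).  Both volume letters of `HEram` are this ONE number —
the ramified counterpart of ★ (B-5v) `measureReal_box_eq` (`q^(2t)·qᵉ` inert). [cite: Rogawski1990, §4.9 p. 54; §12.2 p. 173] [cite: Casselman1980, §3] -/
theorem measureReal_box_eq_ram (he : v.asIdeal.ramificationIdx' w.1.asIdeal ≠ 1) (h2w : Valued.v (2 : w.1.adicCompletion L) = 1)
    {ϖ : w.1.adicCompletion L} (hϖ : Valued.v ϖ = WithZero.exp (-1 : ℤ)) {ν j : ℕ} (hν : 1 ≤ ν) (hj : j ≤ 1)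
    [MeasurableSpace ↥(cmBorelTriple L 3 v).N] [BorelSpace ↥(cmBorelTriple L 3 v).N] (μ : Measure ↥(cmBorelTriple L 3 v).N) [μ.IsHaarMeasure] :
    μ.real {n : ↥(cmBorelTriple L 3 v).N | Valued.v ((((((n : ↥(unitaryGroupOfForm (conjLocal L (IsCMField.complexConj L) v) (cmLocalForm L 3 v)))) : GL (Fin 3) (LocalRing L v)) : Matrix (Fin 3) (Fin 3) (LocalRing L v)) 0 2) w) ≤ Valued.v ϖ ^ j ∧ Valued.v ((((((n : ↥(unitaryGroupOfForm (conjLocal L (IsCMField.complexConj L) v) (cmLocalForm L 3 v)))) : GL (Fin 3) (LocalRing L v)) : Matrix (Fin 3) (Fin 3) (LocalRing L v)) 0 1) w) ≤ Valued.v ϖ ^ ν} =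
      (Ideal.absNorm w.1.asIdeal : ℝ) ^ (-(ν : ℤ)) * μ.real {m : ↥(cmBorelTriple L 3 v).N | Valued.v ((((((m : ↥(unitaryGroupOfForm (conjLocal L (IsCMField.complexConj L) v) (cmLocalForm L 3 v)))) : GL (Fin 3) (LocalRing L v)) : Matrix (Fin 3) (Fin 3) (LocalRing L v)) 0 2) w) ≤ 1} := by
  haveI : SecondCountableTopology (LocalRing L v) := secondCountableTopology_localRing (E := L) v
  letI : MeasurableSpace (LocalRing L v) := borel _
  haveI : BorelSpace (LocalRing L v) := ⟨rfl⟩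
  letI : Invertible (2 : LocalRing L v) := (UnitaryGroup.isUnit_two_localRing L v).invertible
  haveI := HeisRing.locallyCompactSpace_skewPart (conjLocal L (IsCMField.complexConj L) v) (continuous_conjLocal L (IsCMField.complexConj L) v)
  haveI : SecondCountableTopology ↥(HeisRing.skewPart (conjLocal L (IsCMField.complexConj L) v)) := TopologicalSpace.Subtype.secondCountableTopology _
  obtain ⟨μX, hμX⟩ : ∃ m : Measure (LocalRing L v), m = Measure.addHaar := ⟨_, rfl⟩
  obtain ⟨μY, hμY⟩ : ∃ m : Measure ↥(HeisRing.skewPart (conjLocal L (IsCMField.complexConj L) v)), m = Measure.addHaar := ⟨_, rfl⟩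
  haveI : μX.IsAddHaarMeasure := by rw [hμX]; infer_instance
  haveI : μX.Regular := by rw [hμX]; infer_instance
  haveI : μY.IsAddHaarMeasure := by rw [hμY]; infer_instance
  obtain ⟨κ, hκ⟩ := exists_measure_eq_mul_of_preimage_heisHomeomorph L v μ μX μY
  have hB := hκ _ _ _ (preimage_heisHomeomorph_box L v w hw he h2w hϖ hν hj)
  have hN := hκ _ _ _ (preimage_heisHomeomorph_setOf_v_le_one L v w hw h2w)
  -- `μ_R{|x| ≤ |ϖ|^ν} = (N𝔓_w)^(−ν) · μ_R(𝒪)`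
  have hpow : Valued.v ϖ ^ ν = WithZero.exp (-(ν : ℤ)) := by
    rw [hϖ, ← WithZero.exp_nsmul, smul_neg, nsmul_eq_mul, mul_one]
  have hA : (μX {x : LocalRing L v | Valued.v (x w) ≤ Valued.v ϖ ^ ν}).toReal =
      (Ideal.absNorm w.1.asIdeal : ℝ) ^ (-(ν : ℤ)) * (μX {x : LocalRing L v | Valued.v (x w) ≤ 1}).toReal := by
    rw [← measureReal_def, ← measureReal_def, hpow]
    exact BposRamShellMeasurability.measureReal_setOf_valued_le_exp_any L v w hw μX (-(ν : ℤ))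
  simp only [measureReal_def, hB, hN, ENNReal.toReal_mul, hA]
  ring

/-! ## §2 The ∃-body of `HEram` from the indicator identities, the two cut-off values and the `C`-dichotomy -/

include hw in
set_option maxHeartbeats 4000000 in
set_option synthInstance.maxHeartbeats 400000 in
-- the `SmoothInd` carrier on `U(Φ₃)(L⁺_v)` in the four integrands (class of ★ (8)) and the GL-coercion chain in every set
/-- **(8⁺a) THE FOUR ENTRIES OF THE CASSELMAN PAIR AT A TAME RAMIFIED PLACE, FROM THE CUT-OFFS.**  `v` non-split (`hns`), RAMIFIED in `L` at `w` (`he`), `|2|_w = 1`,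
`|ϖ|_w = exp(−1)`; `χ₁` continuous and contracting (so `F₀` is integrable on `{|z| ≥ 1}` ★); `Π` any unit (`X := χ₁(σΠ·Π)`); `1 ≤ ν`; `w₀ ∈ U(Φ₃)(L⁺_v)`; `μ` a Haar measure
on `N(L⁺_v)`; `f₁, f_w` in the `SmoothInd` carrier of `i(χ₁, 1)`.  LETTERS: (i) the four pointwise indicator identities `hI11 hIww hIw1 hI1w` (`f₁(w₀n) = 𝟙_{C(ν,1)}F₀`,
`f_w(w₀nw₀) = 𝟙_{C(ν,0)}F₀`, `f_w(w₀n) = 𝟙_{B(ν,0)}`, `f₁(w₀nw₀) = 𝟙_{B(ν,1)}`) in the CONCLUSION BYTES of R90-C10-p02 (g3)'s FILE B `R90S1BposPairIntegrandIndicatorsTwoDepth`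
(`toFun_weyl_mul_eq_indicator_cutoff` ∕ `toFun_conj_weyl_eq_indicator_cutoff` ∕ `toFun_weyl_mul_eq_indicator_box` ∕ `toFun_conj_weyl_eq_indicator_box` at `r₁ = r₂ = ν`);
(ii) `hmeas` (the cut shells are Borel) and the two cut-off values `hcut1 : ∫_{C(ν,1)} F₀ = C·X·(1−X)⁻¹`, `hcut0 : ∫_{C(ν,0)} F₀ = C·X·(1−X)⁻¹` in the BYTES of ★ p864460 (6c)
`R90S1BposRamMasterIntegral.setIntegral_cutoff_eq_of_even_odd_shells` at `j₀ := 1, 0` (same `C`); (iii) `hCdich : C = 0 ∨ (hFε ∧ C²·X = (q^ν·μ.real B(ν,0))²·((q−1)²·(q^(2ν+1))⁻¹))`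
— `V` OF RECORD `q ^ ν * ↑(μ.real B(ν,0))` (dealer R-S1-27), `q = N𝔓_w`, `hFε` the (R-b) witness in ★ (7)'s bytes; paid by (6d) `R90S1BposRamOddShellValues` (R90-C10-p03 (g2)) and
(a′) (R90-C10-p08 (g2)).  CONCLUSION = the ∃-body of `HEram` of ★ (8) `exists_eta_of_reducible_posDepth_normTrivial_ramifiedTame_of_pairEntries` VERBATIM, with `V₁ = V₂ :=
q^ν·μ.real B(ν,0)` (§1: both boxes have volume `q^(−ν)·μ.real N₀`) and `Γ := C∕V`.  Proof: `∫ 𝟙_S·g = ∫_S g`, integrability ★ `integrableOn_F₀_S_ge` ∕ finite boxes (`B ⊆ N₀`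
compact ★), `μ N₀ > 0` (`N₀ ⊇ {|z| < 1}` open ∋ 1), §1, and the algebra of ★ (6c) §3. [cite: Keys1984, §3, §7 Theorem (2) (d) p. 126] [cite: Casselman1980, §3] [cite: Roche1998, §3–§4]
[cite: Rogawski1990, §12.2 (1)–(2) p. 173] -/
theorem HEram_body_of_cutoffs (hns : ∀ w' : PlacesOver L v, IsCMField.complexConj L • w'.1 = w'.1)
    (he : v.asIdeal.ramificationIdx' w.1.asIdeal ≠ 1) (h2w : Valued.v (2 : w.1.adicCompletion L) = 1)
    {ϖ : w.1.adicCompletion L} (hϖ : Valued.v ϖ = WithZero.exp (-1 : ℤ)) (piU : (LocalRing L v)ˣ)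
    (χ₁ : (LocalRing L v)ˣ →* ℂˣ) (h₁ : Continuous fun x => ((χ₁ x : ℂˣ) : ℂ))
    (hcontr : ∀ x : (LocalRing L v)ˣ, unitModulusChar (LocalRing L v) x < 1 → ‖((χ₁ x : ℂˣ) : ℂ)‖ < 1)
    {ν : ℕ} (hν : 1 ≤ ν) (w₀ : ↥(unitaryGroupOfForm (conjLocal L (IsCMField.complexConj L) v) (cmLocalForm L 3 v)))
    [MeasurableSpace ↥(cmBorelTriple L 3 v).N] [BorelSpace ↥(cmBorelTriple L 3 v).N] (μ : Measure ↥(cmBorelTriple L 3 v).N) [μ.IsHaarMeasure]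
    (f₁ f_w : haveI := locallyCompactSpace_cmBorelU L 3 v
      Representation.SmoothInd (cmBorelTriple L 3 v).P
        (Representation.twist (((Representation.trivial ℂ ↥(torusU (conjLocal L (IsCMField.complexConj L) v) (cmLocalForm L 3 v)) ℂ).twist
          (cmTorusCharPair L v χ₁ 1)).comp (cmBorelTriple L 3 v).proj) (rootDeltaChar (cmBorelTriple L 3 v).P)))
    (hI11 : ∀ n : ↥(cmBorelTriple L 3 v).N, f₁.toFun (w₀ * (n : ↥(unitaryGroupOfForm (conjLocal L (IsCMField.complexConj L) v) (cmLocalForm L 3 v)))) = Set.indicator {n : ↥(cmBorelTriple L 3 v).N | WithZero.exp (1 : ℤ) ≤ Valued.v ((((((n : ↥(unitaryGroupOfForm (conjLocal L (IsCMField.complexConj L) v) (cmLocalForm L 3 v)))) : GL (Fin 3) (LocalRing L v)) : Matrix (Fin 3) (Fin 3) (LocalRing L v)) 0 2) w) ∧ Valued.v ((((((n : ↥(unitaryGroupOfForm (conjLocal L (IsCMField.complexConj L) v) (cmLocalForm L 3 v)))) : GL (Fin 3) (LocalRing L v)) : Matrix (Fin 3) (Fin 3) (LocalRing L v)) 0 1)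 w) ≤ Valued.v ϖ ^ ν * Valued.v ((((((n : ↥(unitaryGroupOfForm (conjLocal L (IsCMField.complexConj L) v) (cmLocalForm L 3 v)))) : GL (Fin 3) (LocalRing L v)) : Matrix (Fin 3) (Fin 3) (LocalRing L v)) 0 2) w)}
      (fun n : ↥(cmBorelTriple L 3 v).N =>
        if h : IsUnit (((((n : ↥(unitaryGroupOfForm (conjLocal L (IsCMField.complexConj L) v) (cmLocalForm L 3 v)))) : GL (Fin 3) (LocalRing L v)) : Matrix (Fin 3) (Fin 3) (LocalRing L v)) 0 2) then
          ((((χ₁ (Units.map ((conjLocal L (IsCMField.complexConj L) v) : LocalRing L v →* LocalRing L v) h.unit))⁻¹ : ℂˣ) : ℂ) *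
            ((((unitModulusChar (LocalRing L v) h.unit)⁻¹ : ℝ≥0) : ℝ) : ℂ))
        else 0) n)
    (hIww : ∀ n : ↥(cmBorelTriple L 3 v).N, f_w.toFun (w₀ * (n : ↥(unitaryGroupOfForm (conjLocal L (IsCMField.complexConj L) v) (cmLocalForm L 3 v))) * w₀) = Set.indicator {n : ↥(cmBorelTriple L 3 v).N | WithZero.exp (0 : ℤ) ≤ Valued.v ((((((n : ↥(unitaryGroupOfForm (conjLocal L (IsCMField.complexConj L) v) (cmLocalForm L 3 v)))) : GL (Fin 3) (LocalRing L v)) : Matrix (Fin 3) (Fin 3) (LocalRing L v)) 0 2) w) ∧ Valued.v ((((((n : ↥(unitaryGroupOfForm (conjLocal L (IsCMField.complexConj L) v) (cmLocalForm L 3 v)))) : GL (Fin 3) (LocalRing L v)) : Matrix (Fin 3) (Fin 3) (LocalRing L v)) 0 1) w) ≤ Valued.v ϖ ^ ν * Valued.v ((((((n : ↥(unitaryGroupOfForm (conjLocal L (IsCMField.complexConj L) v) (cmLocalForm L 3 v)))) : GL (Fin 3) (LocalRing L v)) : Matrix (Fin 3) (Fin 3) (LocalRing L v)) 0 2) w)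}
      (fun n : ↥(cmBorelTriple L 3 v).N =>
        if h : IsUnit (((((n : ↥(unitaryGroupOfForm (conjLocal L (IsCMField.complexConj L) v) (cmLocalForm L 3 v)))) : GL (Fin 3) (LocalRing L v)) : Matrix (Fin 3) (Fin 3) (LocalRing L v)) 0 2) then
          ((((χ₁ (Units.map ((conjLocal L (IsCMField.complexConj L) v) : LocalRing L v →* LocalRing L v) h.unit))⁻¹ : ℂˣ) : ℂ) *
            ((((unitModulusChar (LocalRing L v) h.unit)⁻¹ : ℝ≥0) : ℝ) : ℂ))
        else 0) n)
    (hIw1 : ∀ n : ↥(cmBorelTriple L 3 v).N, f_w.toFun (w₀ * (n : ↥(unitaryGroupOfForm (conjLocal L (IsCMField.complexConj L) v) (cmLocalForm L 3 v)))) = Set.indicator {n : ↥(cmBorelTriple L 3 v).N | Valued.v ((((((n : ↥(unitaryGroupOfForm (conjLocal L (IsCMField.complexConj L) v) (cmLocalForm L 3 v)))) : GL (Fin 3) (LocalRing L v)) : Matrix (Fin 3) (Fin 3) (LocalRing L v)) 0 2) w) ≤ Valued.v ϖ ^ 0 ∧ Valued.v ((((((n : ↥(unitaryGroupOfForm (conjLocal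 L (IsCMField.complexConj L) v) (cmLocalForm L 3 v)))) : GL (Fin 3) (LocalRing L v)) : Matrix (Fin 3) (Fin 3) (LocalRing L v)) 0 1) w) ≤ Valued.v ϖ ^ ν} (fun _ => (1 : ℂ)) n)
    (hI1w : ∀ n : ↥(cmBorelTriple L 3 v).N, f₁.toFun (w₀ * (n : ↥(unitaryGroupOfForm (conjLocal L (IsCMField.complexConj L) v) (cmLocalForm L 3 v))) * w₀) = Set.indicator {n : ↥(cmBorelTriple L 3 v).N | Valued.v ((((((n : ↥(unitaryGroupOfForm (conjLocal L (IsCMField.complexConj L) v) (cmLocalForm L 3 v)))) : GL (Fin 3) (LocalRing L v)) : Matrix (Fin 3) (Fin 3) (LocalRing L v)) 0 2) w) ≤ Valued.v ϖ ^ 1 ∧ Valued.v ((((((n : ↥(unitaryGroupOfForm (conjLocal L (IsCMField.complexConj L) v) (cmLocalForm L 3 v)))) : GL (Fin 3) (LocalRing L v)) : Matrix (Fin 3) (Fin 3) (LocalRing L v)) 0 1) w) ≤ Valued.v ϖ ^ ν} (fun _ => (1 : ℂ)) n)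
    (hmeas : ∀ j t : ℤ, MeasurableSet {m : ↥(cmBorelTriple L 3 v).N |
      Valued.v ((((((m : ↥(unitaryGroupOfForm (conjLocal L (IsCMField.complexConj L) v) (cmLocalForm L 3 v)))) : GL (Fin 3) (LocalRing L v)) : Matrix (Fin 3) (Fin 3) (LocalRing L v)) 0 2) w) = WithZero.exp j ∧
      Valued.v ((((((m : ↥(unitaryGroupOfForm (conjLocal L (IsCMField.complexConj L) v) (cmLocalForm L 3 v)))) : GL (Fin 3) (LocalRing L v)) : Matrix (Fin 3) (Fin 3) (LocalRing L v)) 0 1) w) ≤ WithZero.exp t})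
    (C : ℂ)
    (hcut1 : ∫ n in {n : ↥(cmBorelTriple L 3 v).N | WithZero.exp (((1 : ℕ)) : ℤ) ≤ Valued.v ((((((n : ↥(unitaryGroupOfForm (conjLocal L (IsCMField.complexConj L) v) (cmLocalForm L 3 v)))) : GL (Fin 3) (LocalRing L v)) : Matrix (Fin 3) (Fin 3) (LocalRing L v)) 0 2) w) ∧ Valued.v ((((((n : ↥(unitaryGroupOfForm (conjLocal L (IsCMField.complexConj L) v) (cmLocalForm L 3 v)))) : GL (Fin 3) (LocalRing L v)) : Matrix (Fin 3) (Fin 3) (LocalRing L v)) 0 1) w) ≤ Valued.v ϖ ^ ν * Valued.v ((((((n : ↥(unitaryGroupOfForm (conjLocal L (IsCMField.complexConj L) v) (cmLocalForm L 3 v)))) : GL (Fin 3) (LocalRing L v)) : Matrix (Fin 3) (Fin 3) (LocalRing L v)) 0 2) w)}, (fun n : ↥(cmBorelTriple L 3 v).N =>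
        if h : IsUnit (((((n : ↥(unitaryGroupOfForm (conjLocal L (IsCMField.complexConj L) v) (cmLocalForm L 3 v)))) : GL (Fin 3) (LocalRing L v)) : Matrix (Fin 3) (Fin 3) (LocalRing L v)) 0 2) then
          ((((χ₁ (Units.map ((conjLocal L (IsCMField.complexConj L) v) : LocalRing L v →* LocalRing L v) h.unit))⁻¹ : ℂˣ) : ℂ) *
            ((((unitModulusChar (LocalRing L v) h.unit)⁻¹ : ℝ≥0) : ℝ) : ℂ))
        else 0) n ∂μ = C * ((χ₁ (Units.map (conjLocal L (IsCMField.complexConj L) v : LocalRing L v →* LocalRing L v) piU * piU) : ℂˣ) : ℂ) * (1 - ((χ₁ (Units.map (conjLocal L (IsCMField.complexConj L) v : LocalRing L v →* LocalRing L v) piU * piU) : ℂˣ) : ℂ))⁻¹)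
    (hcut0 : ∫ n in {n : ↥(cmBorelTriple L 3 v).N | WithZero.exp (((0 : ℕ)) : ℤ) ≤ Valued.v ((((((n : ↥(unitaryGroupOfForm (conjLocal L (IsCMField.complexConj L) v) (cmLocalForm L 3 v)))) : GL (Fin 3) (LocalRing L v)) : Matrix (Fin 3) (Fin 3) (LocalRing L v)) 0 2) w) ∧ Valued.v ((((((n : ↥(unitaryGroupOfForm (conjLocal L (IsCMField.complexConj L) v) (cmLocalForm L 3 v)))) : GL (Fin 3) (LocalRing L v)) : Matrix (Fin 3) (Fin 3) (LocalRing L v)) 0 1) w) ≤ Valued.v ϖ ^ ν * Valued.v ((((((n : ↥(unitaryGroupOfForm (conjLocal L (IsCMField.complexConj L) v) (cmLocalForm L 3 v)))) : GL (Fin 3) (LocalRing L v)) : Matrix (Fin 3) (Fin 3) (LocalRing L v)) 0 2) w)}, (fun n : ↥(cmBorelTriple L 3 v).N =>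
        if h : IsUnit (((((n : ↥(unitaryGroupOfForm (conjLocal L (IsCMField.complexConj L) v) (cmLocalForm L 3 v)))) : GL (Fin 3) (LocalRing L v)) : Matrix (Fin 3) (Fin 3) (LocalRing L v)) 0 2) then
          ((((χ₁ (Units.map ((conjLocal L (IsCMField.complexConj L) v) : LocalRing L v →* LocalRing L v) h.unit))⁻¹ : ℂˣ) : ℂ) *
            ((((unitModulusChar (LocalRing L v) h.unit)⁻¹ : ℝ≥0) : ℝ) : ℂ))
        else 0) n ∂μ = C * ((χ₁ (Units.map (conjLocal L (IsCMField.complexConj L) v : LocalRing L v →* LocalRing L v) piU * piU) : ℂˣ) : ℂ) * (1 - ((χ₁ (Units.map (conjLocal L (IsCMField.complexConj L) v : LocalRing L v →* LocalRing L v) piU * piU) : ℂˣ) : ℂ))⁻¹)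
    (hCdich : C = 0 ∨
      ((∃ a : (LocalRing L v)ˣ, Units.map (conjLocal L (IsCMField.complexConj L) v : LocalRing L v →* LocalRing L v) a = a ∧
            (∀ w' : PlacesOver L v, Valued.v ((a : LocalRing L v) w') = 1) ∧ χ₁ a ≠ 1) ∧
        C ^ 2 * ((χ₁ (Units.map (conjLocal L (IsCMField.complexConj L) v : LocalRing L v →* LocalRing L v) piU * piU) : ℂˣ) : ℂ) = (((Ideal.absNorm w.1.asIdeal : ℝ) : ℂ) ^ ν * ((μ.real {n : ↥(cmBorelTriple L 3 v).N | Valued.v ((((((n : ↥(unitaryGroupOfForm (conjLocal L (IsCMField.complexConj L) v) (cmLocalForm L 3 v)))) : GL (Fin 3) (LocalRing L v)) : Matrix (Fin 3) (Fin 3) (LocalRing L v)) 0 2) w) ≤ Valued.v ϖ ^ 0 ∧ Valued.v ((((((n : ↥(unitaryGroupOfForm (conjLocal L (IsCMField.complexConj L) v) (cmLocalForm L 3 v)))) : GL (Fin 3) (LocalRing L v)) : Matrix (Fin 3) (Fin 3) (LocalRing L v)) 0 1) w) ≤ Valued.v ϖ ^ ν} : ℝ) : ℂ)) ^ 2 *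 ((((Ideal.absNorm w.1.asIdeal : ℝ) : ℂ) - 1) ^ 2 * (((Ideal.absNorm w.1.asIdeal : ℝ) : ℂ) ^ (2 * ν + 1))⁻¹))) :
    ∃ V₁ V₂ : ℂ, V₁ ≠ 0 ∧ V₂ ≠ 0 ∧
      Integrable (fun n : ↥(cmBorelTriple L 3 v).N => f₁.toFun (w₀ * (n : ↥(unitaryGroupOfForm (conjLocal L (IsCMField.complexConj L) v) (cmLocalForm L 3 v))) * 1)) μ ∧
      Integrable (fun n : ↥(cmBorelTriple L 3 v).N => f_w.toFun (w₀ * (n : ↥(unitaryGroupOfForm (conjLocal L (IsCMField.complexConj L) v) (cmLocalForm L 3 v))) * 1)) μ ∧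
      Integrable (fun n : ↥(cmBorelTriple L 3 v).N => f₁.toFun (w₀ * (n : ↥(unitaryGroupOfForm (conjLocal L (IsCMField.complexConj L) v) (cmLocalForm L 3 v))) * w₀)) μ ∧
      Integrable (fun n : ↥(cmBorelTriple L 3 v).N => f_w.toFun (w₀ * (n : ↥(unitaryGroupOfForm (conjLocal L (IsCMField.complexConj L) v) (cmLocalForm L 3 v))) * w₀)) μ ∧
      ∫ n : ↥(cmBorelTriple L 3 v).N, f_w.toFun (w₀ * (n : ↥(unitaryGroupOfForm (conjLocal L (IsCMField.complexConj L) v) (cmLocalForm L 3 v))) * 1) ∂μ =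
        (((Ideal.absNorm w.1.asIdeal : ℝ) : ℂ) ^ ν)⁻¹ * V₂ ∧
      ∫ n : ↥(cmBorelTriple L 3 v).N, f₁.toFun (w₀ * (n : ↥(unitaryGroupOfForm (conjLocal L (IsCMField.complexConj L) v) (cmLocalForm L 3 v))) * w₀) ∂μ =
        (((Ideal.absNorm w.1.asIdeal : ℝ) : ℂ) ^ ν)⁻¹ * V₁ ∧
      ((∫ n : ↥(cmBorelTriple L 3 v).N, f₁.toFun (w₀ * (n : ↥(unitaryGroupOfForm (conjLocal L (IsCMField.complexConj L) v) (cmLocalForm L 3 v))) * 1) ∂μ = 0 ∧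
          ∫ n : ↥(cmBorelTriple L 3 v).N, f_w.toFun (w₀ * (n : ↥(unitaryGroupOfForm (conjLocal L (IsCMField.complexConj L) v) (cmLocalForm L 3 v))) * w₀) ∂μ = 0) ∨
        ((∃ a : (LocalRing L v)ˣ, Units.map (conjLocal L (IsCMField.complexConj L) v : LocalRing L v →* LocalRing L v) a = a ∧
            (∀ w' : PlacesOver L v, Valued.v ((a : LocalRing L v) w') = 1) ∧ χ₁ a ≠ 1) ∧
          ∃ Γ : ℂ, Γ ^ 2 * ((χ₁ (Units.map (conjLocal L (IsCMField.complexConj L) v : LocalRing L v →* LocalRing L v) piU * piU) : ℂˣ) : ℂ) =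
              (((Ideal.absNorm w.1.asIdeal : ℝ) : ℂ) - 1) ^ 2 * ((((Ideal.absNorm w.1.asIdeal : ℝ) : ℂ)) ^ (2 * ν + 1))⁻¹ ∧
            ∫ n : ↥(cmBorelTriple L 3 v).N, f₁.toFun (w₀ * (n : ↥(unitaryGroupOfForm (conjLocal L (IsCMField.complexConj L) v) (cmLocalForm L 3 v))) * 1) ∂μ =
              V₁ * (Γ * ((χ₁ (Units.map (conjLocal L (IsCMField.complexConj L) v : LocalRing L v →* LocalRing L v) piU * piU) : ℂˣ) : ℂ) /
                (1 - ((χ₁ (Units.map (conjLocal L (IsCMField.complexConj L) v : LocalRing L v →* LocalRing L v) piU * piU) : ℂˣ) : ℂ))) ∧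
            ∫ n : ↥(cmBorelTriple L 3 v).N, f_w.toFun (w₀ * (n : ↥(unitaryGroupOfForm (conjLocal L (IsCMField.complexConj L) v) (cmLocalForm L 3 v))) * w₀) ∂μ =
              V₂ * (Γ * ((χ₁ (Units.map (conjLocal L (IsCMField.complexConj L) v : LocalRing L v →* LocalRing L v) piU * piU) : ℂˣ) : ℂ) /
                (1 - ((χ₁ (Units.map (conjLocal L (IsCMField.complexConj L) v : LocalRing L v →* LocalRing L v) piU * piU) : ℂˣ) : ℂ))))) := by
  haveI := locallyCompactSpace_cmBorelU L 3 v
  -- the four integrands as indicator functions (p02's FILE B shapes; the `* 1` of `HEram` removed by `mul_one`)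
  have e11 : (fun n : ↥(cmBorelTriple L 3 v).N => f₁.toFun (w₀ * (n : ↥(unitaryGroupOfForm (conjLocal L (IsCMField.complexConj L) v) (cmLocalForm L 3 v))) * 1)) = Set.indicator {n : ↥(cmBorelTriple L 3 v).N | WithZero.exp (1 : ℤ) ≤ Valued.v ((((((n : ↥(unitaryGroupOfForm (conjLocal L (IsCMField.complexConj L) v) (cmLocalForm L 3 v)))) : GL (Fin 3) (LocalRing L v)) : Matrix (Fin 3) (Fin 3) (LocalRing L v)) 0 2) w) ∧ Valued.v ((((((n : ↥(unitaryGroupOfForm (conjLocal L (IsCMField.complexConj L) v) (cmLocalForm L 3 v)))) : GL (Fin 3) (LocalRing L v)) : Matrix (Fin 3) (Fin 3) (LocalRing L v)) 0 1) w) ≤ Valued.v ϖ ^ ν * Valued.v ((((((n : ↥(unitaryGroupOfForm (conjLocal L (IsCMField.complexConj L) v) (cmLocalForm L 3 v)))) : GL (Fin 3) (LocalRing L v)) : Matrix (Fin 3) (Fin 3) (LocalRing L v)) 0 2) w)}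
      (fun n : ↥(cmBorelTriple L 3 v).N =>
        if h : IsUnit (((((n : ↥(unitaryGroupOfForm (conjLocal L (IsCMField.complexConj L) v) (cmLocalForm L 3 v)))) : GL (Fin 3) (LocalRing L v)) : Matrix (Fin 3) (Fin 3) (LocalRing L v)) 0 2) then
          ((((χ₁ (Units.map ((conjLocal L (IsCMField.complexConj L) v) : LocalRing L v →* LocalRing L v) h.unit))⁻¹ : ℂˣ) : ℂ) *
            ((((unitModulusChar (LocalRing L v) h.unit)⁻¹ : ℝ≥0) : ℝ) : ℂ))
        else 0) := funext fun n => by rw [mul_one]; exact hI11 n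
  have eww : (fun n : ↥(cmBorelTriple L 3 v).N => f_w.toFun (w₀ * (n : ↥(unitaryGroupOfForm (conjLocal L (IsCMField.complexConj L) v) (cmLocalForm L 3 v))) * w₀)) = Set.indicator {n : ↥(cmBorelTriple L 3 v).N | WithZero.exp (0 : ℤ) ≤ Valued.v ((((((n : ↥(unitaryGroupOfForm (conjLocal L (IsCMField.complexConj L) v) (cmLocalForm L 3 v)))) : GL (Fin 3) (LocalRing L v)) : Matrix (Fin 3) (Fin 3) (LocalRing L v)) 0 2) w) ∧ Valued.v ((((((n : ↥(unitaryGroupOfForm (conjLocal L (IsCMField.complexConj L) v) (cmLocalForm L 3 v)))) : GL (Fin 3) (LocalRing L v)) : Matrix (Fin 3) (Fin 3) (LocalRing L v)) 0 1) w) ≤ Valued.v ϖ ^ ν * Valued.v ((((((n : ↥(unitaryGroupOfForm (conjLocal L (IsCMField.complexConj L) v) (cmLocalForm L 3 v)))) : GL (Fin 3) (LocalRing L v)) : Matrix (Fin 3) (Fin 3) (LocalRing L v)) 0 2) w)}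
      (fun n : ↥(cmBorelTriple L 3 v).N =>
        if h : IsUnit (((((n : ↥(unitaryGroupOfForm (conjLocal L (IsCMField.complexConj L) v) (cmLocalForm L 3 v)))) : GL (Fin 3) (LocalRing L v)) : Matrix (Fin 3) (Fin 3) (LocalRing L v)) 0 2) then
          ((((χ₁ (Units.map ((conjLocal L (IsCMField.complexConj L) v) : LocalRing L v →* LocalRing L v) h.unit))⁻¹ : ℂˣ) : ℂ) *
            ((((unitModulusChar (LocalRing L v) h.unit)⁻¹ : ℝ≥0) : ℝ) : ℂ))
        else 0) := funext hIww
  have ew1 : (fun n : ↥(cmBorelTriple L 3 v).N => f_w.toFun (w₀ * (n : ↥(unitaryGroupOfForm (conjLocal L (IsCMField.complexConj L) v) (cmLocalForm L 3 v))) * 1)) = Set.indicator {n : ↥(cmBorelTriple L 3 v).N | Valued.v ((((((n : ↥(unitaryGroupOfForm (conjLocal L (IsCMField.complexConj L) v) (cmLocalForm L 3 v)))) : GL (Fin 3) (LocalRing L v)) : Matrix (Fin 3) (Fin 3) (LocalRing L v)) 0 2) w) ≤ Valued.v ϖ ^ 0 ∧ Valued.v ((((((n : ↥(unitaryGroupOfForm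 (conjLocal L (IsCMField.complexConj L) v) (cmLocalForm L 3 v)))) : GL (Fin 3) (LocalRing L v)) : Matrix (Fin 3) (Fin 3) (LocalRing L v)) 0 1) w) ≤ Valued.v ϖ ^ ν} (fun _ => (1 : ℂ)) :=
    funext fun n => by rw [mul_one]; exact hIw1 n
  have e1w : (fun n : ↥(cmBorelTriple L 3 v).N => f₁.toFun (w₀ * (n : ↥(unitaryGroupOfForm (conjLocal L (IsCMField.complexConj L) v) (cmLocalForm L 3 v))) * w₀)) = Set.indicator {n : ↥(cmBorelTriple L 3 v).N | Valued.v ((((((n : ↥(unitaryGroupOfForm (conjLocal L (IsCMField.complexConj L) v) (cmLocalForm L 3 v)))) : GL (Fin 3) (LocalRing L v)) : Matrix (Fin 3) (Fin 3) (LocalRing L v)) 0 2) w) ≤ Valued.v ϖ ^ 1 ∧ Valued.v ((((((n : ↥(unitaryGroupOfForm (conjLocal L (IsCMField.complexConj L) v) (cmLocalForm L 3 v)))) : GL (Fin 3) (LocalRing L v)) : Matrix (Fin 3) (Fin 3) (LocalRing L v)) 0 1) w) ≤ Valued.v ϖ ^ ν} (fun _ => (1 : ℂ)) := funext hI1w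
  -- the cut-offs are Borel (unions of cut shells ★ part 3a) and lie in `{|z| ≥ 1}`, where `F₀` is integrable ★ ((6c)'s `(j₀ : ℤ)` casts normalised to p02's literals)
  have hCm : ∀ j₀ : ℕ, MeasurableSet {n : ↥(cmBorelTriple L 3 v).N | WithZero.exp (j₀ : ℤ) ≤ Valued.v ((((((n : ↥(unitaryGroupOfForm (conjLocal L (IsCMField.complexConj L) v) (cmLocalForm L 3 v)))) : GL (Fin 3) (LocalRing L v)) : Matrix (Fin 3) (Fin 3) (LocalRing L v)) 0 2) w) ∧ Valued.v ((((((n : ↥(unitaryGroupOfForm (conjLocal L (IsCMField.complexConj L) v) (cmLocalForm L 3 v)))) : GL (Fin 3) (LocalRing L v)) : Matrix (Fin 3) (Fin 3) (LocalRing L v)) 0 1) w) ≤ Valued.v ϖ ^ ν * Valued.v ((((((n : ↥(unitaryGroupOfForm (conjLocal L (IsCMField.complexConj L) v) (cmLocalForm L 3 v)))) : GL (Fin 3) (LocalRing L v)) : Matrix (Fin 3) (Fin 3) (LocalRing L v)) 0 2) w)} := fun j₀ => by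
    rw [← BposCutoffShellSum.iUnion_shell_cut_eq_cutoff L v w hϖ ν j₀]
    exact MeasurableSet.iUnion fun i => hmeas _ _
  have hSge := K2E3BranchBShellScalingFromWeightSeries.integrableOn_F₀_S_ge L v w hw hns χ₁ h₁ hcontr μ
  have hsub : ∀ j₀ : ℕ, {n : ↥(cmBorelTriple L 3 v).N | WithZero.exp (j₀ : ℤ) ≤ Valued.v ((((((n : ↥(unitaryGroupOfForm (conjLocal L (IsCMField.complexConj L) v) (cmLocalForm L 3 v)))) : GL (Fin 3) (LocalRing L v)) : Matrix (Fin 3) (Fin 3) (LocalRing L v)) 0 2) w) ∧ Valued.v ((((((n : ↥(unitaryGroupOfForm (conjLocal L (IsCMField.complexConj L) v) (cmLocalForm L 3 v)))) : GL (Fin 3) (LocalRing L v)) : Matrix (Fin 3) (Fin 3) (LocalRing L v)) 0 1) w) ≤ Valued.v ϖ ^ ν * Valued.v ((((((n : ↥(unitaryGroupOfForm (conjLocal L (IsCMField.complexConj L) v) (cmLocalForm L 3 v)))) : GL (Fin 3) (LocalRing L v)) : Matrix (Fin 3) (Fin 3) (LocalRing L v)) 0 2) w)} ⊆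
      {m : ↥(cmBorelTriple L 3 v).N | 1 ≤ Valued.v ((((((m : ↥(unitaryGroupOfForm (conjLocal L (IsCMField.complexConj L) v) (cmLocalForm L 3 v)))) : GL (Fin 3) (LocalRing L v)) : Matrix (Fin 3) (Fin 3) (LocalRing L v)) 0 2) w)} := fun j₀ n hn => by
    simp only [Set.mem_setOf_eq] at hn ⊢
    exact le_trans (by rw [← WithZero.exp_zero]; exact WithZero.exp_le_exp.2 (by omega)) hn.1
  have hC1m : MeasurableSet {n : ↥(cmBorelTriple L 3 v).N | WithZero.exp (1 : ℤ) ≤ Valued.v ((((((n : ↥(unitaryGroupOfForm (conjLocal L (IsCMField.complexConj L) v) (cmLocalForm L 3 v)))) : GL (Fin 3) (LocalRing L v)) : Matrix (Fin 3) (Fin 3) (LocalRing L v)) 0 2) w) ∧ Valued.v ((((((n : ↥(unitaryGroupOfForm (conjLocal L (IsCMField.complexConj L) v) (cmLocalForm L 3 v)))) : GL (Fin 3) (LocalRing L v)) : Matrix (Fin 3) (Fin 3) (LocalRing L v)) 0 1) w) ≤ Valued.v ϖ ^ ν * Valued.v ((((((n : ↥(unitaryGroupOfForm (conjLocal L (IsCMField.complexConj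 L) v) (cmLocalForm L 3 v)))) : GL (Fin 3) (LocalRing L v)) : Matrix (Fin 3) (Fin 3) (LocalRing L v)) 0 2) w)} := by
    simpa only [Nat.cast_one] using hCm 1
  have hC0m : MeasurableSet {n : ↥(cmBorelTriple L 3 v).N | WithZero.exp (0 : ℤ) ≤ Valued.v ((((((n : ↥(unitaryGroupOfForm (conjLocal L (IsCMField.complexConj L) v) (cmLocalForm L 3 v)))) : GL (Fin 3) (LocalRing L v)) : Matrix (Fin 3) (Fin 3) (LocalRing L v)) 0 2) w) ∧ Valued.v ((((((n : ↥(unitaryGroupOfForm (conjLocal L (IsCMField.complexConj L) v) (cmLocalForm L 3 v)))) : GL (Fin 3) (LocalRing L v)) : Matrix (Fin 3) (Fin 3) (LocalRing L v)) 0 1) w) ≤ Valued.v ϖ ^ ν * Valued.v ((((((n : ↥(unitaryGroupOfForm (conjLocal L (IsCMField.complexConj L) v) (cmLocalForm L 3 v)))) : GL (Fin 3) (LocalRing L v)) : Matrix (Fin 3) (Fin 3) (LocalRing L v)) 0 2) w)} := by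
    simpa only [Nat.cast_zero] using hCm 0
  have hF1 : IntegrableOn (fun n : ↥(cmBorelTriple L 3 v).N =>
        if h : IsUnit (((((n : ↥(unitaryGroupOfForm (conjLocal L (IsCMField.complexConj L) v) (cmLocalForm L 3 v)))) : GL (Fin 3) (LocalRing L v)) : Matrix (Fin 3) (Fin 3) (LocalRing L v)) 0 2) then
          ((((χ₁ (Units.map ((conjLocal L (IsCMField.complexConj L) v) : LocalRing L v →* LocalRing L v) h.unit))⁻¹ : ℂˣ) : ℂ) *
            ((((unitModulusChar (LocalRing L v) h.unit)⁻¹ : ℝ≥0) : ℝ) : ℂ))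
        else 0) {n : ↥(cmBorelTriple L 3 v).N | WithZero.exp (1 : ℤ) ≤ Valued.v ((((((n : ↥(unitaryGroupOfForm (conjLocal L (IsCMField.complexConj L) v) (cmLocalForm L 3 v)))) : GL (Fin 3) (LocalRing L v)) : Matrix (Fin 3) (Fin 3) (LocalRing L v)) 0 2) w) ∧ Valued.v ((((((n : ↥(unitaryGroupOfForm (conjLocal L (IsCMField.complexConj L) v) (cmLocalForm L 3 v)))) : GL (Fin 3) (LocalRing L v)) : Matrix (Fin 3) (Fin 3) (LocalRing L v)) 0 1) w) ≤ Valued.v ϖ ^ ν * Valued.v ((((((n : ↥(unitaryGroupOfForm (conjLocal L (IsCMField.complexConj L) v) (cmLocalForm L 3 v)))) : GL (Fin 3) (LocalRing L v)) : Matrix (Fin 3) (Fin 3) (LocalRing L v)) 0 2) w)} μ := by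
    simpa only [Nat.cast_one] using hSge.mono_set (hsub 1)
  have hF0 : IntegrableOn (fun n : ↥(cmBorelTriple L 3 v).N =>
        if h : IsUnit (((((n : ↥(unitaryGroupOfForm (conjLocal L (IsCMField.complexConj L) v) (cmLocalForm L 3 v)))) : GL (Fin 3) (LocalRing L v)) : Matrix (Fin 3) (Fin 3) (LocalRing L v)) 0 2) then
          ((((χ₁ (Units.map ((conjLocal L (IsCMField.complexConj L) v) : LocalRing L v →* LocalRing L v) h.unit))⁻¹ : ℂˣ) : ℂ) *
            ((((unitModulusChar (LocalRing L v) h.unit)⁻¹ : ℝ≥0) : ℝ) : ℂ))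
        else 0) {n : ↥(cmBorelTriple L 3 v).N | WithZero.exp (0 : ℤ) ≤ Valued.v ((((((n : ↥(unitaryGroupOfForm (conjLocal L (IsCMField.complexConj L) v) (cmLocalForm L 3 v)))) : GL (Fin 3) (LocalRing L v)) : Matrix (Fin 3) (Fin 3) (LocalRing L v)) 0 2) w) ∧ Valued.v ((((((n : ↥(unitaryGroupOfForm (conjLocal L (IsCMField.complexConj L) v) (cmLocalForm L 3 v)))) : GL (Fin 3) (LocalRing L v)) : Matrix (Fin 3) (Fin 3) (LocalRing L v)) 0 1) w) ≤ Valued.v ϖ ^ ν * Valued.v ((((((n : ↥(unitaryGroupOfForm (conjLocal L (IsCMField.complexConj L) v) (cmLocalForm L 3 v)))) : GL (Fin 3) (LocalRing L v)) : Matrix (Fin 3) (Fin 3) (LocalRing L v)) 0 2) w)} μ := by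
    simpa only [Nat.cast_zero] using hSge.mono_set (hsub 0)
  have hcut1' : ∫ n in {n : ↥(cmBorelTriple L 3 v).N | WithZero.exp (1 : ℤ) ≤ Valued.v ((((((n : ↥(unitaryGroupOfForm (conjLocal L (IsCMField.complexConj L) v) (cmLocalForm L 3 v)))) : GL (Fin 3) (LocalRing L v)) : Matrix (Fin 3) (Fin 3) (LocalRing L v)) 0 2) w) ∧ Valued.v ((((((n : ↥(unitaryGroupOfForm (conjLocal L (IsCMField.complexConj L) v) (cmLocalForm L 3 v)))) : GL (Fin 3) (LocalRing L v)) : Matrix (Fin 3) (Fin 3) (LocalRing L v)) 0 1) w) ≤ Valued.v ϖ ^ ν * Valued.v ((((((n : ↥(unitaryGroupOfForm (conjLocal L (IsCMField.complexConj L) v) (cmLocalForm L 3 v)))) : GL (Fin 3) (LocalRing L v)) : Matrix (Fin 3) (Fin 3) (LocalRing L v)) 0 2) w)}, (fun n : ↥(cmBorelTriple L 3 v).N =>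
        if h : IsUnit (((((n : ↥(unitaryGroupOfForm (conjLocal L (IsCMField.complexConj L) v) (cmLocalForm L 3 v)))) : GL (Fin 3) (LocalRing L v)) : Matrix (Fin 3) (Fin 3) (LocalRing L v)) 0 2) then
          ((((χ₁ (Units.map ((conjLocal L (IsCMField.complexConj L) v) : LocalRing L v →* LocalRing L v) h.unit))⁻¹ : ℂˣ) : ℂ) *
            ((((unitModulusChar (LocalRing L v) h.unit)⁻¹ : ℝ≥0) : ℝ) : ℂ))
        else 0) n ∂μ = C * ((χ₁ (Units.map (conjLocal L (IsCMField.complexConj L) v : LocalRing L v →* LocalRing L v) piU * piU) : ℂˣ) : ℂ) * (1 - ((χ₁ (Units.map (conjLocal L (IsCMField.complexConj L) v : LocalRing L v →* LocalRing L v) piU * piU) : ℂˣ) : ℂ))⁻¹ := by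
    simpa only [Nat.cast_one] using hcut1
  have hcut0' : ∫ n in {n : ↥(cmBorelTriple L 3 v).N | WithZero.exp (0 : ℤ) ≤ Valued.v ((((((n : ↥(unitaryGroupOfForm (conjLocal L (IsCMField.complexConj L) v) (cmLocalForm L 3 v)))) : GL (Fin 3) (LocalRing L v)) : Matrix (Fin 3) (Fin 3) (LocalRing L v)) 0 2) w) ∧ Valued.v ((((((n : ↥(unitaryGroupOfForm (conjLocal L (IsCMField.complexConj L) v) (cmLocalForm L 3 v)))) : GL (Fin 3) (LocalRing L v)) : Matrix (Fin 3) (Fin 3) (LocalRing L v)) 0 1) w) ≤ Valued.v ϖ ^ ν * Valued.v ((((((n : ↥(unitaryGroupOfForm (conjLocal L (IsCMField.complexConj L) v) (cmLocalForm L 3 v)))) : GL (Fin 3) (LocalRing L v)) : Matrix (Fin 3) (Fin 3) (LocalRing L v)) 0 2) w)}, (fun n : ↥(cmBorelTriple L 3 v).N =>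
        if h : IsUnit (((((n : ↥(unitaryGroupOfForm (conjLocal L (IsCMField.complexConj L) v) (cmLocalForm L 3 v)))) : GL (Fin 3) (LocalRing L v)) : Matrix (Fin 3) (Fin 3) (LocalRing L v)) 0 2) then
          ((((χ₁ (Units.map ((conjLocal L (IsCMField.complexConj L) v) : LocalRing L v →* LocalRing L v) h.unit))⁻¹ : ℂˣ) : ℂ) *
            ((((unitModulusChar (LocalRing L v) h.unit)⁻¹ : ℝ≥0) : ℝ) : ℂ))
        else 0) n ∂μ = C * ((χ₁ (Units.map (conjLocal L (IsCMField.complexConj L) v : LocalRing L v →* LocalRing L v) piU * piU) : ℂˣ) : ℂ) * (1 - ((χ₁ (Units.map (conjLocal L (IsCMField.complexConj L) v : LocalRing L v →* LocalRing L v) piU * piU) : ℂˣ) : ℂ))⁻¹ := by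
    simpa only [Nat.cast_zero] using hcut0
  -- the boxes: Borel (open), inside the compact `N₀`, both of volume `q^(−ν)·μ N₀ > 0`
  have hϖ1 : Valued.v ϖ < 1 := by rw [hϖ, ← WithZero.exp_zero]; exact WithZero.exp_lt_exp.2 (by norm_num)
  have hBm : ∀ j : ℕ, MeasurableSet {n : ↥(cmBorelTriple L 3 v).N | Valued.v ((((((n : ↥(unitaryGroupOfForm (conjLocal L (IsCMField.complexConj L) v) (cmLocalForm L 3 v)))) : GL (Fin 3) (LocalRing L v)) : Matrix (Fin 3) (Fin 3) (LocalRing L v)) 0 2) w) ≤ Valued.v ϖ ^ j ∧ Valued.v ((((((n : ↥(unitaryGroupOfForm (conjLocal L (IsCMField.complexConj L) v) (cmLocalForm L 3 v)))) : GL (Fin 3) (LocalRing L v)) : Matrix (Fin 3) (Fin 3) (LocalRing L v)) 0 1) w) ≤ Valued.v ϖ ^ ν} := fun j => (isOpen_box L v w hϖ ν j).measurableSet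
  have hN0c := isCompact_setOf_v_le_one_of_v_two L v w hw h2w
  have hBsub : ∀ j : ℕ, {n : ↥(cmBorelTriple L 3 v).N | Valued.v ((((((n : ↥(unitaryGroupOfForm (conjLocal L (IsCMField.complexConj L) v) (cmLocalForm L 3 v)))) : GL (Fin 3) (LocalRing L v)) : Matrix (Fin 3) (Fin 3) (LocalRing L v)) 0 2) w) ≤ Valued.v ϖ ^ j ∧ Valued.v ((((((n : ↥(unitaryGroupOfForm (conjLocal L (IsCMField.complexConj L) v) (cmLocalForm L 3 v)))) : GL (Fin 3) (LocalRing L v)) : Matrix (Fin 3) (Fin 3) (LocalRing L v)) 0 1) w) ≤ Valued.v ϖ ^ ν} ⊆ {m : ↥(cmBorelTriple L 3 v).N | Valued.v ((((((m : ↥(unitaryGroupOfForm (conjLocal L (IsCMField.complexConj L) v) (cmLocalForm L 3 v)))) : GL (Fin 3) (LocalRing L v)) : Matrix (Fin 3) (Fin 3) (LocalRing L v)) 0 2) w) ≤ 1} :=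
    fun j n hn => le_trans hn.1 (pow_le_one₀ zero_le hϖ1.le)
  have hBfin : ∀ j : ℕ, μ {n : ↥(cmBorelTriple L 3 v).N | Valued.v ((((((n : ↥(unitaryGroupOfForm (conjLocal L (IsCMField.complexConj L) v) (cmLocalForm L 3 v)))) : GL (Fin 3) (LocalRing L v)) : Matrix (Fin 3) (Fin 3) (LocalRing L v)) 0 2) w) ≤ Valued.v ϖ ^ j ∧ Valued.v ((((((n : ↥(unitaryGroupOfForm (conjLocal L (IsCMField.complexConj L) v) (cmLocalForm L 3 v)))) : GL (Fin 3) (LocalRing L v)) : Matrix (Fin 3) (Fin 3) (LocalRing L v)) 0 1) w) ≤ Valued.v ϖ ^ ν} < ∞ :=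
    fun j => lt_of_le_of_lt (measure_mono (hBsub j)) hN0c.measure_lt_top
  have hN0pos : 0 < μ.real {m : ↥(cmBorelTriple L 3 v).N | Valued.v ((((((m : ↥(unitaryGroupOfForm (conjLocal L (IsCMField.complexConj L) v) (cmLocalForm L 3 v)))) : GL (Fin 3) (LocalRing L v)) : Matrix (Fin 3) (Fin 3) (LocalRing L v)) 0 2) w) ≤ 1} := by
    rw [measureReal_def, ENNReal.toReal_pos_iff]
    refine ⟨lt_of_lt_of_le ?_ (measure_mono (fun n (hn : Valued.v ((((((n : ↥(unitaryGroupOfForm (conjLocal L (IsCMField.complexConj L) v) (cmLocalForm L 3 v)))) : GL (Fin 3) (LocalRing L v)) : Matrix (Fin 3) (Fin 3) (LocalRing L v)) 0 2) w) < 1) => le_of_lt hn)), hN0c.measure_lt_top⟩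
    refine ((isOpen_setOf_valued_apply_lt_one L v w).preimage (K2E3BranchBShellRegions.continuous_entry_zero_two L v)).measure_pos μ ⟨1, ?_⟩
    simp only [Set.mem_preimage, Set.mem_setOf_eq, OneMemClass.coe_one, Units.val_one, Matrix.one_apply_ne (by decide : (0 : Fin 3) ≠ 2),
      Pi.zero_apply, map_zero]
    exact zero_lt_one
  have hq1 : (1 : ℝ) < (Ideal.absNorm w.1.asIdeal : ℝ) := by exact_mod_cast NumberField.HeightOneSpectrum.one_lt_absNorm w.1
  have hq0 : ((Ideal.absNorm w.1.asIdeal : ℝ) : ℂ) ≠ 0 := by exact_mod_cast (lt_trans zero_lt_one hq1).ne'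
  have hvolR : ∀ j : ℕ, j ≤ 1 → μ.real {n : ↥(cmBorelTriple L 3 v).N | Valued.v ((((((n : ↥(unitaryGroupOfForm (conjLocal L (IsCMField.complexConj L) v) (cmLocalForm L 3 v)))) : GL (Fin 3) (LocalRing L v)) : Matrix (Fin 3) (Fin 3) (LocalRing L v)) 0 2) w) ≤ Valued.v ϖ ^ j ∧ Valued.v ((((((n : ↥(unitaryGroupOfForm (conjLocal L (IsCMField.complexConj L) v) (cmLocalForm L 3 v)))) : GL (Fin 3) (LocalRing L v)) : Matrix (Fin 3) (Fin 3) (LocalRing L v)) 0 1) w) ≤ Valued.v ϖ ^ ν} =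
      (Ideal.absNorm w.1.asIdeal : ℝ) ^ (-(ν : ℤ)) * μ.real {m : ↥(cmBorelTriple L 3 v).N | Valued.v ((((((m : ↥(unitaryGroupOfForm (conjLocal L (IsCMField.complexConj L) v) (cmLocalForm L 3 v)))) : GL (Fin 3) (LocalRing L v)) : Matrix (Fin 3) (Fin 3) (LocalRing L v)) 0 2) w) ≤ 1} := fun j hj => measureReal_box_eq_ram L v w hw he h2w hϖ hν hj μ
  have hB0pos : 0 < μ.real {n : ↥(cmBorelTriple L 3 v).N | Valued.v ((((((n : ↥(unitaryGroupOfForm (conjLocal L (IsCMField.complexConj L) v) (cmLocalForm L 3 v)))) : GL (Fin 3) (LocalRing L v)) : Matrix (Fin 3) (Fin 3) (LocalRing L v)) 0 2) w) ≤ Valued.v ϖ ^ 0 ∧ Valued.v ((((((n : ↥(unitaryGroupOfForm (conjLocal L (IsCMField.complexConj L) v) (cmLocalForm L 3 v)))) : GL (Fin 3) (LocalRing L v)) : Matrix (Fin 3) (Fin 3) (LocalRing L v)) 0 1) w) ≤ Valued.v ϖ ^ ν} := by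
    rw [hvolR 0 (by norm_num)]
    exact mul_pos (zpow_pos (lt_trans zero_lt_one hq1) _) hN0pos
  have hB10 : ((μ.real {n : ↥(cmBorelTriple L 3 v).N | Valued.v ((((((n : ↥(unitaryGroupOfForm (conjLocal L (IsCMField.complexConj L) v) (cmLocalForm L 3 v)))) : GL (Fin 3) (LocalRing L v)) : Matrix (Fin 3) (Fin 3) (LocalRing L v)) 0 2) w) ≤ Valued.v ϖ ^ 1 ∧ Valued.v ((((((n : ↥(unitaryGroupOfForm (conjLocal L (IsCMField.complexConj L) v) (cmLocalForm L 3 v)))) : GL (Fin 3) (LocalRing L v)) : Matrix (Fin 3) (Fin 3) (LocalRing L v)) 0 1) w) ≤ Valued.v ϖ ^ ν} : ℝ) : ℂ) = ((μ.real {n : ↥(cmBorelTriple L 3 v).N | Valued.v ((((((n : ↥(unitaryGroupOfForm (conjLocal L (IsCMField.complexConj L) v) (cmLocalForm L 3 v)))) : GL (Fin 3) (LocalRing L v)) : Matrix (Fin 3) (Fin 3) (LocalRing L v)) 0 2) w) ≤ Valued.v ϖ ^ 0 ∧ Valued.v ((((((n : ↥(unitaryGroupOfForm (conjLocal L (IsCMField.complexConj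 L) v) (cmLocalForm L 3 v)))) : GL (Fin 3) (LocalRing L v)) : Matrix (Fin 3) (Fin 3) (LocalRing L v)) 0 1) w) ≤ Valued.v ϖ ^ ν} : ℝ) : ℂ) := by
    rw [hvolR 1 le_rfl, hvolR 0 (by norm_num)]
  -- `V₁ = V₂ := q^ν · μ.real B(ν,0)` (the dealer's V OF RECORD)
  have hV : ((Ideal.absNorm w.1.asIdeal : ℝ) : ℂ) ^ ν * ((μ.real {n : ↥(cmBorelTriple L 3 v).N | Valued.v ((((((n : ↥(unitaryGroupOfForm (conjLocal L (IsCMField.complexConj L) v) (cmLocalForm L 3 v)))) : GL (Fin 3) (LocalRing L v)) : Matrix (Fin 3) (Fin 3) (LocalRing L v)) 0 2) w) ≤ Valued.v ϖ ^ 0 ∧ Valued.v ((((((n : ↥(unitaryGroupOfForm (conjLocal L (IsCMField.complexConj L) v) (cmLocalForm L 3 v)))) : GL (Fin 3) (LocalRing L v)) : Matrix (Fin 3) (Fin 3) (LocalRing L v)) 0 1) w) ≤ Valued.v ϖ ^ ν} : ℝ) : ℂ) ≠ 0 :=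
    mul_ne_zero (pow_ne_zero ν hq0) (by exact_mod_cast hB0pos.ne')
  have hinv : ∀ T : ℂ, (((Ideal.absNorm w.1.asIdeal : ℝ) : ℂ) ^ ν)⁻¹ * (((Ideal.absNorm w.1.asIdeal : ℝ) : ℂ) ^ ν * T) = T := fun T => by
    rw [← mul_assoc, inv_mul_cancel₀ (pow_ne_zero ν hq0), one_mul]
  refine ⟨((Ideal.absNorm w.1.asIdeal : ℝ) : ℂ) ^ ν * ((μ.real {n : ↥(cmBorelTriple L 3 v).N | Valued.v ((((((n : ↥(unitaryGroupOfForm (conjLocal L (IsCMField.complexConj L) v) (cmLocalForm L 3 v)))) : GL (Fin 3) (LocalRing L v)) : Matrix (Fin 3) (Fin 3) (LocalRing L v)) 0 2) w) ≤ Valued.v ϖ ^ 0 ∧ Valued.v ((((((n : ↥(unitaryGroupOfForm (conjLocal L (IsCMField.complexConj L) v) (cmLocalForm L 3 v)))) : GL (Fin 3) (LocalRing L v)) : Matrix (Fin 3) (Fin 3) (LocalRing L v)) 0 1) w) ≤ Valued.v ϖ ^ ν} : ℝ) : ℂ), ((Ideal.absNorm w.1.asIdeal : ℝ) : ℂ)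 ^ ν * ((μ.real {n : ↥(cmBorelTriple L 3 v).N | Valued.v ((((((n : ↥(unitaryGroupOfForm (conjLocal L (IsCMField.complexConj L) v) (cmLocalForm L 3 v)))) : GL (Fin 3) (LocalRing L v)) : Matrix (Fin 3) (Fin 3) (LocalRing L v)) 0 2) w) ≤ Valued.v ϖ ^ 0 ∧ Valued.v ((((((n : ↥(unitaryGroupOfForm (conjLocal L (IsCMField.complexConj L) v) (cmLocalForm L 3 v)))) : GL (Fin 3) (LocalRing L v)) : Matrix (Fin 3) (Fin 3) (LocalRing L v)) 0 1) w) ≤ Valued.v ϖ ^ ν} : ℝ) : ℂ), hV, hV, ?_, ?_, ?_, ?_, ?_, ?_, ?_⟩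
  · rw [e11]; exact (integrable_indicator_iff hC1m).2 hF1
  · rw [ew1]; exact (integrable_indicator_iff (hBm 0)).2 (integrableOn_const (hBfin 0).ne)
  · rw [e1w]; exact (integrable_indicator_iff (hBm 1)).2 (integrableOn_const (hBfin 1).ne)
  · rw [eww]; exact (integrable_indicator_iff hC0m).2 hF0
  · -- `Λ_1 f_w = μ.real B(ν,0) = (q^ν)⁻¹·V`
    have h : ∫ n : ↥(cmBorelTriple L 3 v).N, f_w.toFun (w₀ * (n : ↥(unitaryGroupOfForm (conjLocal L (IsCMField.complexConj L) v) (cmLocalForm L 3 v))) * 1) ∂μ = ∫ n : ↥(cmBorelTriple L 3 v).N, Set.indicator {n : ↥(cmBorelTriple L 3 v).N | Valued.v ((((((n : ↥(unitaryGroupOfForm (conjLocal L (IsCMField.complexConj L) v) (cmLocalForm L 3 v)))) : GL (Fin 3) (LocalRing L v)) : Matrix (Fin 3) (Fin 3) (LocalRing L v)) 0 2) w) ≤ Valued.v ϖ ^ 0 ∧ Valued.v ((((((n : ↥(unitaryGroupOfForm (conjLocal L (IsCMField.complexConj L) v) (cmLocalForm L 3 v)))) : GL (Fin 3) (LocalRing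 L v)) : Matrix (Fin 3) (Fin 3) (LocalRing L v)) 0 1) w) ≤ Valued.v ϖ ^ ν} (fun _ => (1 : ℂ)) n ∂μ := by rw [ew1]
    rw [h, integral_indicator_const _ (hBm 0), Complex.real_smul, mul_one, hinv]
  · -- `Λ_{w₀} f₁ = μ.real B(ν,1) = μ.real B(ν,0)` (§1)
    have h : ∫ n : ↥(cmBorelTriple L 3 v).N, f₁.toFun (w₀ * (n : ↥(unitaryGroupOfForm (conjLocal L (IsCMField.complexConj L) v) (cmLocalForm L 3 v))) * w₀) ∂μ = ∫ n : ↥(cmBorelTriple L 3 v).N, Set.indicator {n : ↥(cmBorelTriple L 3 v).N | Valued.v ((((((n : ↥(unitaryGroupOfForm (conjLocal L (IsCMField.complexConj L) v) (cmLocalForm L 3 v)))) : GL (Fin 3) (LocalRing L v)) : Matrix (Fin 3) (Fin 3) (LocalRing L v)) 0 2) w) ≤ Valued.v ϖ ^ 1 ∧ Valued.v ((((((n : ↥(unitaryGroupOfForm (conjLocal L (IsCMField.complexConj L) v) (cmLocalForm L 3 v)))) : GL (Fin 3) (LocalRing L v)) : Matrix (Fin 3) (Fin 3) (LocalRing L v))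 0 1) w) ≤ Valued.v ϖ ^ ν} (fun _ => (1 : ℂ)) n ∂μ := by rw [e1w]
    rw [h, integral_indicator_const _ (hBm 1), Complex.real_smul, mul_one, hinv, hB10]
  · -- the two big-cell entries are the two cut-off values; dichotomy
    have h11 : ∫ n : ↥(cmBorelTriple L 3 v).N, f₁.toFun (w₀ * (n : ↥(unitaryGroupOfForm (conjLocal L (IsCMField.complexConj L) v) (cmLocalForm L 3 v))) * 1) ∂μ = C * ((χ₁ (Units.map (conjLocal L (IsCMField.complexConj L) v : LocalRing L v →* LocalRing L v) piU * piU) : ℂˣ) : ℂ) * (1 - ((χ₁ (Units.map (conjLocal L (IsCMField.complexConj L) v : LocalRing L v →* LocalRing L v) piU * piU) : ℂˣ) : ℂ))⁻¹ := by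
      have h : ∫ n : ↥(cmBorelTriple L 3 v).N, f₁.toFun (w₀ * (n : ↥(unitaryGroupOfForm (conjLocal L (IsCMField.complexConj L) v) (cmLocalForm L 3 v))) * 1) ∂μ = ∫ n : ↥(cmBorelTriple L 3 v).N, Set.indicator {n : ↥(cmBorelTriple L 3 v).N | WithZero.exp (1 : ℤ) ≤ Valued.v ((((((n : ↥(unitaryGroupOfForm (conjLocal L (IsCMField.complexConj L) v) (cmLocalForm L 3 v)))) : GL (Fin 3) (LocalRing L v)) : Matrix (Fin 3) (Fin 3) (LocalRing L v)) 0 2) w) ∧ Valued.v ((((((n : ↥(unitaryGroupOfForm (conjLocal L (IsCMField.complexConj L) v) (cmLocalForm L 3 v)))) : GL (Fin 3) (LocalRing L v)) : Matrix (Fin 3) (Fin 3) (LocalRing L v)) 0 1) w) ≤ Valued.v ϖ ^ ν * Valued.v ((((((n : ↥(unitaryGroupOfForm (conjLocal L (IsCMField.complexConj L) v) (cmLocalForm L 3 v)))) : GL (Fin 3) (LocalRing L v)) : Matrix (Fin 3) (Fin 3) (LocalRing L v)) 0 2) w)}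
          (fun n : ↥(cmBorelTriple L 3 v).N =>
        if h : IsUnit (((((n : ↥(unitaryGroupOfForm (conjLocal L (IsCMField.complexConj L) v) (cmLocalForm L 3 v)))) : GL (Fin 3) (LocalRing L v)) : Matrix (Fin 3) (Fin 3) (LocalRing L v)) 0 2) then
          ((((χ₁ (Units.map ((conjLocal L (IsCMField.complexConj L) v) : LocalRing L v →* LocalRing L v) h.unit))⁻¹ : ℂˣ) : ℂ) *
            ((((unitModulusChar (LocalRing L v) h.unit)⁻¹ : ℝ≥0) : ℝ) : ℂ))
        else 0) n ∂μ := by rw [e11]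
      rw [h, integral_indicator hC1m, hcut1']
    have hww : ∫ n : ↥(cmBorelTriple L 3 v).N, f_w.toFun (w₀ * (n : ↥(unitaryGroupOfForm (conjLocal L (IsCMField.complexConj L) v) (cmLocalForm L 3 v))) * w₀) ∂μ = C * ((χ₁ (Units.map (conjLocal L (IsCMField.complexConj L) v : LocalRing L v →* LocalRing L v) piU * piU) : ℂˣ) : ℂ) * (1 - ((χ₁ (Units.map (conjLocal L (IsCMField.complexConj L) v : LocalRing L v →* LocalRing L v) piU * piU) : ℂˣ) : ℂ))⁻¹ := by
      have h : ∫ n : ↥(cmBorelTriple L 3 v).N, f_w.toFun (w₀ * (n : ↥(unitaryGroupOfForm (conjLocal L (IsCMField.complexConj L) v) (cmLocalForm L 3 v))) * w₀) ∂μ = ∫ n : ↥(cmBorelTriple L 3 v).N, Set.indicator {n : ↥(cmBorelTriple L 3 v).N | WithZero.exp (0 : ℤ) ≤ Valued.v ((((((n : ↥(unitaryGroupOfForm (conjLocal L (IsCMField.complexConj L) v) (cmLocalForm L 3 v)))) : GL (Fin 3) (LocalRing L v)) : Matrix (Fin 3) (Fin 3) (LocalRing L v)) 0 2) w) ∧ Valued.v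 ((((((n : ↥(unitaryGroupOfForm (conjLocal L (IsCMField.complexConj L) v) (cmLocalForm L 3 v)))) : GL (Fin 3) (LocalRing L v)) : Matrix (Fin 3) (Fin 3) (LocalRing L v)) 0 1) w) ≤ Valued.v ϖ ^ ν * Valued.v ((((((n : ↥(unitaryGroupOfForm (conjLocal L (IsCMField.complexConj L) v) (cmLocalForm L 3 v)))) : GL (Fin 3) (LocalRing L v)) : Matrix (Fin 3) (Fin 3) (LocalRing L v)) 0 2) w)}
          (fun n : ↥(cmBorelTriple L 3 v).N =>
        if h : IsUnit (((((n : ↥(unitaryGroupOfForm (conjLocal L (IsCMField.complexConj L) v) (cmLocalForm L 3 v)))) : GL (Fin 3) (LocalRing L v)) : Matrix (Fin 3) (Fin 3) (LocalRing L v)) 0 2) then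
          ((((χ₁ (Units.map ((conjLocal L (IsCMField.complexConj L) v) : LocalRing L v →* LocalRing L v) h.unit))⁻¹ : ℂˣ) : ℂ) *
            ((((unitModulusChar (LocalRing L v) h.unit)⁻¹ : ℝ≥0) : ℝ) : ℂ))
        else 0) n ∂μ := by rw [eww]
      rw [h, integral_indicator hC0m, hcut0']
    rcases hCdich with hC0 | ⟨hFε, hC2⟩
    · exact Or.inl ⟨by rw [h11, hC0, zero_mul, zero_mul], by rw [hww, hC0, zero_mul, zero_mul]⟩
    · refine Or.inr ⟨hFε, C / (((Ideal.absNorm w.1.asIdeal : ℝ) : ℂ) ^ ν * ((μ.real {n : ↥(cmBorelTriple L 3 v).N | Valued.v ((((((n : ↥(unitaryGroupOfForm (conjLocal L (IsCMField.complexConj L) v) (cmLocalForm L 3 v)))) : GL (Fin 3) (LocalRing L v)) : Matrix (Fin 3) (Fin 3) (LocalRing L v)) 0 2) w) ≤ Valued.v ϖ ^ 0 ∧ Valued.v ((((((n : ↥(unitaryGroupOfForm (conjLocal L (IsCMField.complexConj L) v) (cmLocalForm L 3 v)))) : GL (Fin 3) (LocalRing L v)) : Matrix (Fin 3) (Fin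 3) (LocalRing L v)) 0 1) w) ≤ Valued.v ϖ ^ ν} : ℝ) : ℂ)), ?_, ?_, ?_⟩
      · rw [div_pow, div_mul_eq_mul_div, hC2, mul_div_cancel_left₀ _ (pow_ne_zero 2 hV)]
      · rw [h11]; exact entry_shape C _ _ hV
      · rw [hww]; exact entry_shape C _ _ hV

end Summit.HodgeConjecture.HodgeConjecture.R90.S1.BposRamPairEntriesOfShells

end
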